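import Summits.RiemannHypothesis.RiemannHypothesis.Theorems.DBNNoCoalescence
import Summits.RiemannHypothesis.RiemannHypothesis.Theorems.DBNCoalescenceAtLambda

/-!
# RiemannHypothesis / DBN — the door of column DBN made unconditional: `NoCoalescence ↔ RH`

LINE 1 — LABEL: `DbnTheory.NoCoalescence` (no coalescence of real zeros of `H_t` at any positive
time) is **RH-EQUIVALENT**, now certified BY DECL in both directions with no hypothesis
(`noCoalescence_iff_riemannHypothesis_holds`); the RH-FREE leaf K2 `DbnTheory.CoalescenceAtLambda`
is DISCHARGED (`CoalescenceAtLambda_holds`, from `coalescenceAtLambda` of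
`Theorems/DBNCoalescenceAtLambda.lean`).  bears_on: N-C/N-P (LADDER-RH §1, COLUMN 3 DBN; C3 corpus
`rh-crit/rt`, RESIDUAL.md).  WHAT THIS IS NOT: an equivalence is not a proof — the residual stays
exactly as hard as RH; nothing here bears on the truth of RH.

One-line consequences of `Theorems/DBNNoCoalescence.lean` (glue modulo K2) and
`Theorems/DBNCoalescenceAtLambda.lean` (K2 proved):

* `CoalescenceAtLambda_holds : CoalescenceAtLambda`;
* `NoCoalescenceDetectsRH : Prop := NoCoalescence → RiemannHypothesis` — THE DOOR as a named
  statement (RH-FREE: an implication whose antecedent is the RH-EQUIVALENT residual; the shape of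
  `DeBrangesSuzukiDoor.WitnessDetectsRH`; offered to the planners as the leaf of record of a
  «NewmanFlow» line, `rh-crit/rt/RESIDUAL.md` §3) and its proof `NoCoalescenceDetectsRH_holds` =
  `riemannHypothesis_of_noCoalescence_holds : NoCoalescence → RiemannHypothesis`;
* `noCoalescence_iff_riemannHypothesis_holds`, `noCoalescence_iff_dbnThesis_holds`
  (↔ route-DBN target X, stmt-RiemannHypothesis-0274), `noCoalescence_iff_summit_holds`,
  `deBruijnNewmanConst_eq_zero_iff_noCoalescence` (with Rodgers–Tao `Λ ≥ 0`).

`--supports stmt-RiemannHypothesis-0274`; closes nothing (X ↔ RH ↔ NoCoalescence: the item is RH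
itself).  Theorems plus the one named door `Prop`.
-/

noncomputable section

-- D-0017: `Summit.<S>.<S>.…` is the designed namespace of a single-problem summit.
set_option linter.dupNamespace false

namespace Summit.RiemannHypothesis.RiemannHypothesis.Theorems.DbnTheory

open Literature.NumberTheory.LFunctions
open Summit.RiemannHypothesis.RiemannHypothesis.Theses

/-- **K2 discharged**: `CoalescenceAtLambda` holds (`coalescenceAtLambda`). [folklore] -/
theorem CoalescenceAtLambda_holds : CoalescenceAtLambda := fun h ↦ coalescenceAtLambda h

/-- **THE DOOR, unconditional**: no coalescence at positive times ⟹ RH. RH-FREE theorem about the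
RH-EQUIVALENT residual; nothing here bears on the truth of RH. [folklore] -/
theorem riemannHypothesis_of_noCoalescence_holds (h : NoCoalescence) : RiemannHypothesis :=
  riemannHypothesis_of_noCoalescence CoalescenceAtLambda_holds h

/-- **RH-FREE — THE DOOR as a named statement** (leaf-of-record candidate for a «NewmanFlow» line;
shape of `DeBrangesSuzukiDoor.WitnessDetectsRH`): the RH-EQUIVALENT residual `NoCoalescence`
implies the Riemann Hypothesis.  PROVED (`NoCoalescenceDetectsRH_holds`).  An implication, not a
proof of its antecedent; nothing here bears on the truth of RH.  (Untagged: a statement about the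
tree's `H_t`, not a named fact from print.) -/
def NoCoalescenceDetectsRH : Prop := NoCoalescence → RiemannHypothesis

/-- The door holds. [folklore] -/
theorem NoCoalescenceDetectsRH_holds : NoCoalescenceDetectsRH :=
  fun h ↦ riemannHypothesis_of_noCoalescence_holds h

/-- **`NoCoalescence ↔ RH`** — the isolated statement of column DBN is RH-EQUIVALENT by decl, both
directions kernel-checked, no hypotheses. [folklore] -/
theorem noCoalescence_iff_riemannHypothesis_holds : NoCoalescence ↔ RiemannHypothesis :=
  noCoalescence_iff_riemannHypothesis CoalescenceAtLambda_holds

/-- `NoCoalescence ↔` the route-DBN target X (`DBN.DbnThesis`, stmt-RiemannHypothesis-0274).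
[folklore] -/
theorem noCoalescence_iff_dbnThesis_holds : NoCoalescence ↔ DBN.DbnThesis :=
  noCoalescence_iff_dbnThesis CoalescenceAtLambda_holds

/-- `NoCoalescence ↔ Summit.RiemannHypothesis`. [folklore] -/
theorem noCoalescence_iff_summit_holds : NoCoalescence ↔ Summit.RiemannHypothesis :=
  noCoalescence_iff_summit CoalescenceAtLambda_holds

/-- With Rodgers–Tao `Λ ≥ 0` (`deBruijnNewmanConst_nonneg_holds`): `Λ = 0 ↔ NoCoalescence`.
[folklore] -/
theorem deBruijnNewmanConst_eq_zero_iff_noCoalescence :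
    deBruijnNewmanConst = 0 ↔ NoCoalescence := by
  rw [← riemannHypothesis_iff_deBruijnNewmanConst_eq_zero]
  exact noCoalescence_iff_riemannHypothesis_holds.symm

end Summit.RiemannHypothesis.RiemannHypothesis.Theorems.DbnTheory

end
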